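import Mathlib
import HarnessLib
import Literature.NumberTheory.DiophantineGeometry.RothPrelim
import Literature.NumberTheory.DiophantineGeometry.RothTaylor

/-!
# Roth's theorem after Schmidt (LNM 785, Ch. V) — Theorem 8A: the index at nearby rational points

Source: W. M. Schmidt, *Diophantine Approximation*, LNM 785 (1980), Ch. V §8, Theorem 8A
(book pp. 125–127) [Schmidt1980], in the vocabulary of `RothPrelim` / `RothTaylor`
(`Roth.hasseD`, `Roth.height`, `Roth.wt`, `Roth.IndexGe`).

**Theorem 8A** (`Roth.indexGe_nearbyRationals`, PROVED). Let `P(X₁,…,Xₘ) ∈ ℤ[X]` have degree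
`≤ r_h` in `X_h`, height `|P| ≤ B^{r₁+⋯+rₘ}` (`B ≥ 1`) and index `≥ (m/2)(1-ε)` at `(α,…,α)`
with respect to `(r₁,…,rₘ)` — the conclusions of the Index Theorem 7A. Suppose `0 < δ < 1`,
`0 < ε < δ/36` (8.1), and let `p₁/q₁,…,pₘ/qₘ` (`q_h > 0`) satisfy
`|α - p_h/q_h| < q_h^{-2-δ}` (8.2), `q_h^δ > D` (8.3) and
`r₁ log q₁ ≤ r_h log q_h ≤ (1+ε) r₁ log q₁` (8.4). Then `P` has index `≥ εm` at
`(p₁/q₁,…,pₘ/qₘ)` with respect to `(r₁,…,rₘ)`. Here `D = D(α, B) = (16 B max(1,|α|))⁴`;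
Schmidt's standing assumptions of §8 that `α` is an algebraic integer of degree `d ≥ 2` and that
`m > 16ε⁻² log 4d` are not used in the proof of 8A and are not required here (they matter for
7A and §11). The index `0 : Fin m` plays the role of Schmidt's `h = 1`.

Proof as printed: for `T = P_j` with `Σ j_h/r_h < εm`, Lemma 5A twice and the evaluation bound
`Roth.abs_aeval_le_of_degreeOf_le` give `|T_i(α,…,α)| ≤ C^{Σr}` with `C = 8B max(1,|α|)`
((8.5)); Lemma 6A (i) kills the Taylor coefficients `T_i(α,…,α)` with
`Σ i_h/r_h < (m/2)(1-ε) - Σ j_h/r_h`; for the others (8.2) and (8.4) give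
`Π_h |p_h/q_h - α|^{i_h} ≤ e^{-(2+δ) Σ i_h log q_h} ≤ e^{-(1+δ/4) Σ r_h log q_h}`; summing the at
most `2^{Σ r}` terms of Taylor's formula, `q₁^{r₁}⋯qₘ^{rₘ} |T(p/q)| ≤ Π_h (2C q_h^{-δ/4})^{r_h} < 1`
by (8.3), while `q₁^{r₁}⋯qₘ^{rₘ} T(p/q) ∈ ℤ` (`Roth.exists_int_aeval_mul_prod_pow`), so
`T(p/q) = 0`.

This file is part of the seat-1 line towards `roth` (abc.S13): 8A here, then the §11 assembly
(`RothAssembly`), then Lemma 9A / Theorem 10A (`RothWronskian`, `RothLemma…`); the Index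
Theorem 7A is the subject of `RothAuxLemmas` and its sequel.

## References

* [Schmidt1980] W. M. Schmidt, *Diophantine Approximation*, LNM 785, Springer 1980, Ch. V
  Thm 8A, (8.1)–(8.6), book pp. 125–127.
-/

noncomputable section

open MvPolynomial Finset Real

namespace Literature.NumberTheory.DiophantineGeometry

namespace Roth

variable {m : ℕ}

/-! ### Counting, evaluation and denominator bounds for integer polynomials in a box -/

/-- A polynomial of degree `≤ r_h` in `X_h` has at most `∏ₕ (r_h + 1)` monomials.
[cite: Schmidt1980, Ch. V §8 (p. 126)] -/
theorem card_support_le_of_degreeOf_le {R : Type*} [CommSemiring R] (P : MvPolynomial (Fin m) R)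
    (r : Fin m → ℕ) (hr : ∀ h, P.degreeOf h ≤ r h) : P.support.card ≤ ∏ h, (r h + 1) := by
  classical
  calc P.support.card ≤ (Fintype.piFinset fun h => Finset.range (r h + 1)).card := by
        refine Finset.card_le_card_of_injOn (fun j => ⇑j) ?_ ?_
        · intro j hj
          simp only [Finset.mem_coe, Fintype.mem_piFinset, Finset.mem_range, Nat.lt_succ_iff]
          exact fun h => (monomial_le_degreeOf h hj).trans (hr h)
        · intro j₁ _ j₂ _ h
          exact DFunLike.coe_injective h
    _ = ∏ h, (r h + 1) := by
        rw [Fintype.card_piFinset]; simp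

/-- A box `Iic d` of multi-indices has at most (in fact exactly) `∏ₕ (d_h + 1)` elements.
[folklore] -/
theorem card_Iic_finsupp_le (d : Fin m →₀ ℕ) : (Finset.Iic d).card ≤ ∏ h, (d h + 1) := by
  classical
  calc (Finset.Iic d).card ≤ (Fintype.piFinset fun h => Finset.range (d h + 1)).card := by
        refine Finset.card_le_card_of_injOn (fun j => ⇑j) ?_ ?_
        · intro j hj
          rw [Finset.mem_coe, Finset.mem_Iic] at hj
          simp only [Finset.mem_coe, Fintype.mem_piFinset, Finset.mem_range, Nat.lt_succ_iff]
          exact fun h => hj h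
        · intro j₁ _ j₂ _ h
          exact DFunLike.coe_injective h
    _ = ∏ h, (d h + 1) := by
        rw [Fintype.card_piFinset]; simp

/-- `∏ₕ (r_h + 1) ≤ 2^{Σ r_h}` (Schmidt, p. 126: "a sum of at most `(r₁+1)⋯(rₘ+1) ≤ 2^{r₁+⋯+rₘ}`
monomials"). [cite: Schmidt1980, Ch. V §8 (p. 126)] -/
theorem prod_succ_le_two_pow_sum (r : Fin m → ℕ) : ∏ h, (r h + 1) ≤ 2 ^ (∑ h, r h) := by
  rw [← Finset.prod_pow_eq_pow_sum]
  exact Finset.prod_le_prod' fun h _ => Nat.lt_two_pow_self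

/-- Evaluation bound: if `P ∈ ℤ[X₁,…,Xₘ]` has degree `≤ r_h` in `X_h` then
`|P(a)| ≤ (∏ₕ (r_h + 1)) · |P| · ∏ₕ max(1, |a_h|)^{r_h}` (the estimate behind (8.5)).
[cite: Schmidt1980, Ch. V §8 (8.5)] -/
theorem abs_aeval_le_of_degreeOf_le (P : MvPolynomial (Fin m) ℤ) (r : Fin m → ℕ)
    (hr : ∀ h, P.degreeOf h ≤ r h) (a : Fin m → ℝ) :
    |aeval a P| ≤ (∏ h, ((r h : ℝ) + 1)) * height P * ∏ h, (max 1 |a h|) ^ (r h) := by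
  classical
  rw [MvPolynomial.aeval_def, MvPolynomial.eval₂_eq']
  refine (Finset.abs_sum_le_sum_abs _ _).trans ?_
  have hterm : ∀ j ∈ P.support, |algebraMap ℤ ℝ (P.coeff j) * ∏ h, a h ^ (j h)| ≤
      (height P : ℝ) * ∏ h, (max 1 |a h|) ^ (r h) := by
    intro j hj
    rw [abs_mul, abs_prod]
    apply mul_le_mul (by simpa using abs_coeff_le_height P j) _ (by positivity) (by positivity)
    apply Finset.prod_le_prod (fun h _ => by positivity)
    intro h _
    rw [abs_pow]
    calc |a h| ^ (j h) ≤ (max 1 |a h|) ^ (j h) :=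
          pow_le_pow_left₀ (abs_nonneg _) (le_max_right _ _) _
      _ ≤ (max 1 |a h|) ^ (r h) :=
          pow_le_pow_right₀ (le_max_left _ _) ((monomial_le_degreeOf h hj).trans (hr h))
  refine (Finset.sum_le_sum hterm).trans ?_
  rw [Finset.sum_const, nsmul_eq_mul, mul_assoc]
  apply mul_le_mul_of_nonneg_right _ (by positivity)
  exact_mod_cast card_support_le_of_degreeOf_le P r hr

/-- Clearing denominators: if `P ∈ ℤ[X₁,…,Xₘ]` has degree `≤ r_h` in `X_h` then
`q₁^{r₁}⋯qₘ^{rₘ} · P(p₁/q₁,…,pₘ/qₘ)` is a rational integer (Schmidt, p. 127: "`T(p/q) = N/q₁^{r₁}⋯qₘ^{rₘ}`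
for some integer `N`"). [cite: Schmidt1980, Ch. V §8 (p. 127)] -/
theorem exists_int_aeval_mul_prod_pow (P : MvPolynomial (Fin m) ℤ) (r : Fin m → ℕ)
    (hr : ∀ h, P.degreeOf h ≤ r h) (p : Fin m → ℤ) (q : Fin m → ℕ) (hq : ∀ h, 0 < q h) :
    ∃ N : ℤ, aeval (fun h => (p h : ℝ) / q h) P * ∏ h, (q h : ℝ) ^ (r h) = N := by
  classical
  refine ⟨∑ j ∈ P.support, P.coeff j * ∏ h, (p h) ^ (j h) * (q h : ℤ) ^ (r h - j h), ?_⟩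
  rw [MvPolynomial.aeval_def, MvPolynomial.eval₂_eq', Finset.sum_mul]
  push_cast
  apply Finset.sum_congr rfl
  intro j hj
  rw [mul_assoc, ← Finset.prod_mul_distrib]
  congr 1
  apply Finset.prod_congr rfl
  intro h _
  have hjr : j h ≤ r h := (monomial_le_degreeOf h hj).trans (hr h)
  have hq0 : (q h : ℝ) ≠ 0 := by exact_mod_cast (hq h).ne'
  rw [div_pow, ← pow_sub_mul_pow (q h : ℝ) hjr]
  field_simp

/-! ### Theorem 8A -/

/-- **Theorem 8A** (Schmidt, LNM 785, Ch. V §8): with `D = D(α, B) = (16 B max(1,|α|))⁴`, an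
integer polynomial `P(X₁,…,Xₘ)` of degree `≤ r_h` in `X_h`, height `≤ B^{Σ r_h}` (`B ≥ 1`) and
index `≥ (m/2)(1-ε)` at `(α,…,α; r₁,…,rₘ)` — the conclusions of the Index Theorem 7A — has
index `≥ εm` at `(p₁/q₁,…,pₘ/qₘ; r₁,…,rₘ)` whenever `0 < δ < 1`, `0 < ε < δ/36` (8.1),
`|α - p_h/q_h| < q_h^{-2-δ}` (8.2), `q_h^δ > D` (8.3) and
`r₁ log q₁ ≤ r_h log q_h ≤ (1+ε) r₁ log q₁` (8.4), `q_h > 0`. (Schmidt's standing hypotheses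
"`α` an algebraic integer of degree `d ≥ 2`, `m > 16ε⁻² log 4d`, `r_h ≥ 1`" are not used by
the printed proof and are dropped; `0 : Fin m` is Schmidt's index `1`.)
[cite: Schmidt1980, Ch. V Thm 8A (pp. 125–127)] -/
theorem indexGe_nearbyRationals (α B : ℝ) (hB : 1 ≤ B) :
    ∃ D : ℝ, 0 < D ∧
    ∀ (m : ℕ) (hm : 0 < m) (ε δ : ℝ), 0 < δ → δ < 1 → 0 < ε → ε < δ / 36 →
    ∀ (r : Fin m → ℕ), (∀ h, 0 < r h) →
    ∀ (P : MvPolynomial (Fin m) ℤ), (∀ h, P.degreeOf h ≤ r h) →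
      (height P : ℝ) ≤ B ^ (∑ h, r h) → IndexGe P (fun _ : Fin m => α) r (m / 2 * (1 - ε)) →
    ∀ (p : Fin m → ℤ) (q : Fin m → ℕ), (∀ h, 0 < q h) →
      (∀ h, |α - p h / q h| < (q h : ℝ) ^ (-(2 + δ) : ℝ)) →
      (∀ h, D < (q h : ℝ) ^ δ) →
      (∀ h, r ⟨0, hm⟩ * Real.log (q ⟨0, hm⟩) ≤ r h * Real.log (q h)) →
      (∀ h, r h * Real.log (q h) ≤ (1 + ε) * (r ⟨0, hm⟩ * Real.log (q ⟨0, hm⟩))) →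
    IndexGe P (fun h => (p h : ℝ) / q h) r (ε * m) := by
  classical
  -- the constants `C = 8 B max(1,|α|)` and `D = (2C)^4`
  set A : ℝ := max 1 |α| with hA_def
  have hA1 : 1 ≤ A := le_max_left _ _
  set C : ℝ := 8 * B * A with hC_def
  have hC8 : 8 ≤ C := by
    have : (1 : ℝ) * 1 ≤ B * A := mul_le_mul hB hA1 zero_le_one (by linarith)
    rw [hC_def]; linarith
  have hC0 : 0 < C := by linarith
  refine ⟨(2 * C) ^ 4, by positivity, ?_⟩
  intro m hm ε δ hδ0 hδ1 hε0 hε36 r hr P hPdeg hPht hPind p q hq happrox hqD hR1 hR2 j hj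
  haveI : Nonempty (Fin m) := Fin.pos_iff_nonempty.mp hm
  set i₀ : Fin m := ⟨0, hm⟩ with hi₀_def
  -- the polynomial `T = P_j`
  set T := hasseD j P with hT_def
  have hTdeg : ∀ h, T.degreeOf h ≤ r h := fun h =>
    (degreeOf_hasseD_le h j P).trans ((Nat.sub_le _ _).trans (hPdeg h))
  -- sizes of the denominators
  have hqR : ∀ h, (0 : ℝ) < q h := fun h => by exact_mod_cast hq h
  have hq1 : ∀ h, (1 : ℝ) < q h := by
    intro h
    by_contra hle
    push Not at hle
    have h1 : (q h : ℝ) ^ δ ≤ 1 := Real.rpow_le_one (hqR h).le hle hδ0.le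
    have h2 : (1 : ℝ) ≤ (2 * C) ^ 4 := one_le_pow₀ (by linarith)
    linarith [hqD h]
  have hL0 : ∀ h, 0 < Real.log (q h) := fun h => Real.log_pos (hq1 h)
  have hlogC : ∀ h, Real.log (2 * C) < δ / 4 * Real.log (q h) := by
    intro h
    have h1 := Real.log_lt_log (by positivity) (hqD h)
    rw [Real.log_pow, Real.log_rpow (hqR h)] at h1
    push_cast at h1
    linarith
  set W : ℝ := (r i₀ : ℝ) * Real.log (q i₀) with hW_def
  have hW0 : 0 < W := mul_pos (by exact_mod_cast hr i₀) (hL0 i₀)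
  set Sr : ℝ := ∑ h, (r h : ℝ) * Real.log (q h) with hSr_def
  have hSr_le : Sr ≤ m * ((1 + ε) * W) := by
    calc Sr ≤ ∑ _h : Fin m, (1 + ε) * W := Finset.sum_le_sum fun h _ => hR2 h
      _ = m * ((1 + ε) * W) := by simp
  -- Step 1: `|T_i(α, …, α)| ≤ C^{∑ r}` for every `i` ((8.5))
  have hTi : ∀ i, |aeval (fun _ => α) (hasseD i T)| ≤ C ^ (∑ h, r h) := by
    intro i
    have hdeg' : ∀ h, (hasseD i T).degreeOf h ≤ r h := fun h =>
      (degreeOf_hasseD_le h i T).trans ((Nat.sub_le _ _).trans (hTdeg h))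
    have h1 := abs_aeval_le_of_degreeOf_le (hasseD i T) r hdeg' (fun _ => α)
    -- heights: `|T_i| ≤ 2^{∑r} |T| ≤ 4^{∑r} |P| ≤ (4B)^{∑ r}`
    have hht : (height (hasseD i T) : ℝ) ≤ (4 * B) ^ (∑ h, r h) := by
      have e1 : (height (hasseD i T) : ℝ) ≤ 2 ^ (∑ h, r h) * height T := by
        exact_mod_cast height_hasseD_le i T r hTdeg
      have e2 : (height T : ℝ) ≤ 2 ^ (∑ h, r h) * height P := by
        exact_mod_cast height_hasseD_le j P r hPdeg
      calc (height (hasseD i T) : ℝ) ≤ 2 ^ (∑ h, r h) * (2 ^ (∑ h, r h) * B ^ (∑ h, r h)) := by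
            refine e1.trans (mul_le_mul_of_nonneg_left (e2.trans ?_) (by positivity))
            exact mul_le_mul_of_nonneg_left hPht (by positivity)
        _ = (4 * B) ^ (∑ h, r h) := by rw [← mul_assoc, ← mul_pow, ← mul_pow]; norm_num
    have hAprod : ∏ h : Fin m, (max 1 |α|) ^ (r h) = A ^ (∑ h, r h) :=
      Finset.prod_pow_eq_pow_sum _ _ _
    have hsumr : ((∏ h, ((r h : ℝ) + 1)) : ℝ) ≤ 2 ^ (∑ h, r h) := by
      exact_mod_cast prod_succ_le_two_pow_sum r
    rw [hAprod] at h1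
    calc |aeval (fun _ => α) (hasseD i T)|
        ≤ (∏ h, ((r h : ℝ) + 1)) * height (hasseD i T) * A ^ (∑ h, r h) := h1
      _ ≤ 2 ^ (∑ h, r h) * (4 * B) ^ (∑ h, r h) * A ^ (∑ h, r h) := by gcongr
      _ = C ^ (∑ h, r h) := by rw [← mul_pow, ← mul_pow, hC_def]; ring
  -- Step 2: `T_i(α, …, α) = 0` when `Σ i_h/r_h < (m/2)(1-ε) - Σ j_h/r_h` (Lemma 6A (i))
  have hTi0 : IndexGe T (fun _ => α) r (m / 2 * (1 - ε) - wt r j) := hPind.hasseD j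
  -- Step 3: Taylor's formula at `(α, …, α)` over the box `Iic r`
  set rF : Fin m →₀ ℕ := Finsupp.equivFunOnFinite.symm r with hrF_def
  have hrF : ∀ h, rF h = r h := fun h => by simp [hrF_def]
  have htaylor := taylor_formula_of_subset (fun _ => α) (fun h => (p h : ℝ) / q h) T
    (T := Finset.Iic rF) (fun i hi => mem_Iic_of_hasseD_ne_zero r hTdeg hi)
  -- Step 4: every term of Taylor's formula is `≤ C^{∑ r} e^{-(1 + δ/4) S_r}`
  have hcoef : (1 + δ / 4) * (1 + ε) ≤ (2 + δ) * (1 / 2 * (1 - ε) - ε) := by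
    nlinarith [mul_lt_mul_of_pos_left hδ1 hε0]
  have hterm : ∀ i ∈ Finset.Iic rF,
      |aeval (fun _ => α) (hasseD i T) * ∏ h, ((p h : ℝ) / q h - α) ^ (i h)| ≤
        C ^ (∑ h, r h) * Real.exp (-(1 + δ / 4) * Sr) := by
    intro i _
    by_cases hsmall : wt r i < m / 2 * (1 - ε) - wt r j
    · rw [hTi0 i hsmall, zero_mul, abs_zero]; positivity
    · push Not at hsmall
      rw [abs_mul, Finset.abs_prod]
      set Si : ℝ := ∑ h, (i h : ℝ) * Real.log (q h) with hSi_def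
      -- the approximation hypothesis (8.2)
      have h1 : ∏ h, |((p h : ℝ) / q h - α) ^ (i h)| ≤ Real.exp (-(2 + δ) * Si) := by
        rw [hSi_def, Finset.mul_sum, Real.exp_sum]
        apply Finset.prod_le_prod (fun _ _ => abs_nonneg _)
        intro h _
        rw [abs_pow, abs_sub_comm]
        calc |α - (p h : ℝ) / q h| ^ (i h) ≤ ((q h : ℝ) ^ (-(2 + δ) : ℝ)) ^ (i h) :=
              pow_le_pow_left₀ (abs_nonneg _) (happrox h).le _
          _ = Real.exp (-(2 + δ) * ((i h : ℝ) * Real.log (q h))) := by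
              rw [Real.rpow_def_of_pos (hqR h), ← Real.exp_nat_mul]; ring_nf
      -- (8.4): `(1 + δ/4) S_r ≤ (2 + δ) S_i`
      have hSi : wt r i * W ≤ Si := by
        rw [wt, hSi_def, Finset.sum_mul]
        apply Finset.sum_le_sum
        intro h _
        have hrh : (0 : ℝ) < r h := by exact_mod_cast hr h
        calc (i h : ℝ) / r h * W ≤ (i h : ℝ) / r h * (r h * Real.log (q h)) :=
              mul_le_mul_of_nonneg_left (hR1 h) (by positivity)
          _ = (i h : ℝ) * Real.log (q h) := by field_simp
      have hwtj : wt r j < ε * m := hj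
      have hwt : m / 2 * (1 - ε) - ε * m ≤ wt r i := by linarith
      have h2 : (1 + δ / 4) * Sr ≤ (2 + δ) * Si := by
        have hmW : (0 : ℝ) ≤ m * W := by positivity
        calc (1 + δ / 4) * Sr ≤ (1 + δ / 4) * (m * ((1 + ε) * W)) :=
              mul_le_mul_of_nonneg_left hSr_le (by positivity)
          _ = ((1 + δ / 4) * (1 + ε)) * (m * W) := by ring
          _ ≤ ((2 + δ) * (1 / 2 * (1 - ε) - ε)) * (m * W) :=
              mul_le_mul_of_nonneg_right hcoef hmW
          _ = (2 + δ) * ((m / 2 * (1 - ε) - ε * m) * W) := by ring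
          _ ≤ (2 + δ) * (wt r i * W) := by
              apply mul_le_mul_of_nonneg_left _ (by linarith)
              exact mul_le_mul_of_nonneg_right hwt hW0.le
          _ ≤ (2 + δ) * Si := mul_le_mul_of_nonneg_left hSi (by linarith)
      calc |aeval (fun _ => α) (hasseD i T)| * ∏ h, |((p h : ℝ) / q h - α) ^ (i h)|
          ≤ C ^ (∑ h, r h) * Real.exp (-(2 + δ) * Si) :=
            mul_le_mul (hTi i) h1 (Finset.prod_nonneg fun _ _ => abs_nonneg _) (by positivity)
        _ ≤ C ^ (∑ h, r h) * Real.exp (-(1 + δ / 4) * Sr) := by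
            apply mul_le_mul_of_nonneg_left _ (by positivity)
            exact Real.exp_le_exp.mpr (by linarith)
  -- Step 5: `|T(p/q)| ≤ (2C)^{∑ r} e^{-(1+δ/4) S_r}` ((8.6) and the count of terms)
  have hcard : ((Finset.Iic rF).card : ℝ) ≤ 2 ^ (∑ h, r h) := by
    have h1 : (Finset.Iic rF).card ≤ ∏ h, (rF h + 1) := card_Iic_finsupp_le rF
    have h2 : ∏ h, (rF h + 1) ≤ 2 ^ (∑ h, rF h) := prod_succ_le_two_pow_sum _
    have h3 : (∑ h, rF h) = ∑ h, r h := Finset.sum_congr rfl fun h _ => hrF h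
    rw [h3] at h2
    exact_mod_cast h1.trans h2
  have hTpq : |aeval (fun h => (p h : ℝ) / q h) T| ≤
      2 ^ (∑ h, r h) * (C ^ (∑ h, r h) * Real.exp (-(1 + δ / 4) * Sr)) := by
    rw [htaylor]
    refine (Finset.abs_sum_le_sum_abs _ _).trans ((Finset.sum_le_sum hterm).trans ?_)
    rw [Finset.sum_const, nsmul_eq_mul]
    exact mul_le_mul_of_nonneg_right hcard (by positivity)
  -- Step 6: `q₁^{r₁}⋯qₘ^{rₘ} |T(p/q)| < 1` by (8.3)
  have hprod : ∏ h, (q h : ℝ) ^ (r h) = Real.exp Sr := by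
    rw [hSr_def, Real.exp_sum]
    apply Finset.prod_congr rfl
    intro h _
    rw [← Real.rpow_natCast, Real.rpow_def_of_pos (hqR h)]; ring_nf
  have h2C : (2 : ℝ) ^ (∑ h, r h) * C ^ (∑ h, r h) =
      Real.exp (∑ h, (r h : ℝ) * Real.log (2 * C)) := by
    rw [← mul_pow, ← Finset.sum_mul,
      show (∑ h, (r h : ℝ)) * Real.log (2 * C) = Real.log (2 * C) * ∑ h, (r h : ℝ) from
        mul_comm _ _,
      ← Real.rpow_def_of_pos (by positivity), ← Nat.cast_sum, Real.rpow_natCast]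
  have hneg : ∑ h, ((r h : ℝ) * Real.log (2 * C) + (-(1 + δ / 4) * ((r h : ℝ) * Real.log (q h))
      + (r h : ℝ) * Real.log (q h))) < 0 := by
    have hlt0 : ∑ h : Fin m, (r h : ℝ) * (Real.log (2 * C) - δ / 4 * Real.log (q h)) <
        ∑ _h : Fin m, (0 : ℝ) :=
      Finset.sum_lt_sum_of_nonempty Finset.univ_nonempty fun h _ => by
        have hrh : (0 : ℝ) < r h := by exact_mod_cast hr h
        have := hlogC h
        nlinarith
    rw [Finset.sum_const_zero] at hlt0
    refine lt_of_le_of_lt (le_of_eq (Finset.sum_congr rfl fun h _ => by ring)) hlt0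
  have hlt : |aeval (fun h => (p h : ℝ) / q h) T| * ∏ h, (q h : ℝ) ^ (r h) < 1 := by
    rw [hprod]
    calc |aeval (fun h => (p h : ℝ) / q h) T| * Real.exp Sr
        ≤ 2 ^ (∑ h, r h) * (C ^ (∑ h, r h) * Real.exp (-(1 + δ / 4) * Sr)) * Real.exp Sr :=
          mul_le_mul_of_nonneg_right hTpq (Real.exp_pos _).le
      _ = Real.exp (∑ h, ((r h : ℝ) * Real.log (2 * C) +
            (-(1 + δ / 4) * ((r h : ℝ) * Real.log (q h)) + (r h : ℝ) * Real.log (q h)))) := by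
          rw [← mul_assoc, h2C, ← Real.exp_add, ← Real.exp_add, hSr_def, Finset.mul_sum,
            ← Finset.sum_add_distrib, ← Finset.sum_add_distrib]
          exact congrArg Real.exp (Finset.sum_congr rfl fun h _ => by ring)
      _ < Real.exp 0 := Real.exp_lt_exp.mpr hneg
      _ = 1 := Real.exp_zero
  -- Step 7: integrality forces `T(p/q) = 0`
  obtain ⟨N, hN⟩ := exists_int_aeval_mul_prod_pow T r hTdeg p q hq
  have hprod_pos : 0 < ∏ h, (q h : ℝ) ^ (r h) := Finset.prod_pos fun h _ => pow_pos (hqR h) _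
  have hNabs : |(N : ℝ)| < 1 := by
    rw [← hN, abs_mul, abs_of_pos hprod_pos]; exact hlt
  have hN0 : N = 0 := by
    have : |N| < 1 := by exact_mod_cast hNabs
    exact Int.abs_lt_one_iff.mp this
  rw [hN0, Int.cast_zero, mul_eq_zero] at hN
  exact hN.resolve_right hprod_pos.ne'

end Roth

end Literature.NumberTheory.DiophantineGeometry
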